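import Summits.ResolutionOfSingularities.ResolutionOfSingularities.Theorems.WildConesClassicalRegimesDefs

/-!
# Route `WildCones`, crux `ClassicalRegimes` (stmt-ResolutionOfSingularities-16884), line
# `milnor-descent`: stub `stub_muDropCurve` — the one-step Milnor drop for plane curves (`n = 1`)

We prove `MuDrop p 1 κ` for every prime `p` and every field `κ` of characteristic `p`: along the
point-blow-up dynamics of `z ^ p = a(u)` (one variable `u`), whenever a state `c` and its successor
`step c` are both of multiplicity `p` (in fact only `MultP c` is used), the Milnor-type colength
`μ = dim_κ κ[[u]] ⧸ (∂a/∂u)` strictly drops.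

The argument. In one variable the blow-up chart `bl` and the translation `tr` are identities on
coefficient functions (`bl_zero`, `tr_zero`), and under `MultP c` the cleaned order `m` of `c` is
`≥ p`, so the division exponent of `step` is `p`: coefficientwise,
`(step c)_b = (clean c)_{b + p}` (`step_apply`; the final cleaning never bites because
`p ∣ b ↔ p ∣ b + p`). The cleaned series `f = Σ_k f_k u^k` has order `m` with `p ∤ m` (cleaned) and
`p ≤ m` (`MultP`), hence `m ≥ p + 1` (`ord_spec`). Its derivative `∂f/∂u` vanishes below degree
`m - 1` and has coefficient `m · f_m ≠ 0` there (`(m : κ) ≠ 0` by `CharP κ p` and `p ∤ m`), so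
`(∂f/∂u) = (u ^ (m - 1))` as ideals (`span_eq_span_X_pow`: a series of exact order `k` is `u ^ k`
times a unit) and `μ(c) = dim_κ κ[[u]] ⧸ (u ^ (m - 1)) = m - 1` (`finrank_quot_span_X_pow`, via the
truncation map onto `κ ^ (m - 1)`). The successor `f / u ^ p` has order `m - p` with
`p ∤ m - p`, so `μ(step c) = m - p - 1 < m - 1 = μ(c)`.

Sources: folklore (Milnor number of `z ^ p + a(u)` in characteristic `p`; cf. the `n = 1` order
bookkeeping of `Theorems/ClosingReduction/Negative/DimensionOne.lean`).
-/

noncomputable section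

set_option linter.dupNamespace false

open scoped BigOperators Classical

namespace Summit.ResolutionOfSingularities.ResolutionOfSingularities.Theorems.WildCones

/-! ## One-variable bookkeeping and the two finrank lemmas -/

namespace MuDropCurve

variable {p : ℕ} {κ : Type} [Field κ]

/-- In one variable the (only) blow-up chart is the identity on coefficient functions. [folklore] -/
theorem bl_zero (c : (Fin 1 → ℕ) → κ) : bl 1 κ 0 c = c := by
  funext B
  show @ite κ (Finset.sum (Finset.univ.erase 0) (fun j => B j) ≤ B 0) (Classical.dec _)
    (c (Function.update B 0 (B 0 - Finset.sum (Finset.univ.erase 0) (fun j => B j)))) 0 = c B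
  have h0 : (Finset.univ : Finset (Fin 1)).erase 0 = ∅ := by decide
  simp only [h0, Finset.sum_empty, zero_le, if_true, Nat.sub_zero, Function.update_eq_self]

/-- In one variable the translation is the identity (only `D = 0` contributes). [folklore] -/
theorem tr_zero (τ : Fin 1 → κ) (s : ℕ) (c : (Fin 1 → ℕ) → κ) : tr 1 κ 0 τ s c = c := by
  funext B
  show Finset.sum (Fintype.piFinset (fun _ : Fin 1 => Finset.range (B 0 + s + 1)))
    (fun D => @ite κ (D 0 = 0) (Classical.dec _) (c (B + D) * Finset.prod (Finset.univ.erase 0)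
      (fun j => ((Nat.choose (B j + D j) (B j) : ℕ) : κ) * τ j ^ (D j))) 0) = c B
  have he : (Finset.univ : Finset (Fin 1)).erase 0 = ∅ := by decide
  rw [Finset.sum_eq_single (0 : Fin 1 → ℕ)]
  · rw [if_pos (show (0 : Fin 1 → ℕ) 0 = 0 from rfl), he, Finset.prod_empty, mul_one, add_zero]
  · intro D _ hD
    have hD0 : D 0 ≠ 0 := by
      intro h0
      apply hD
      funext j
      rw [Fin.fin_one_eq_zero j, h0]
      rfl
    rw [if_neg hD0]
  · intro h
    exact absurd (by simp [Fintype.mem_piFinset]) h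

/-- Cleaning is idempotent. [folklore] -/
theorem clean_clean (c : (Fin 1 → ℕ) → κ) : clean p 1 κ (clean p 1 κ c) = clean p 1 κ c := by
  funext A
  show @ite κ (∀ j, p ∣ A j) (Classical.dec _) 0 (@ite κ (∀ j, p ∣ A j) (Classical.dec _) 0 (c A)) =
    @ite κ (∀ j, p ∣ A j) (Classical.dec _) 0 (c A)
  by_cases h : ∀ j, p ∣ A j
  · rw [if_pos h, if_pos h]
  · rw [if_neg h, if_neg h]

/-- A step ends with a cleaning, so its output is clean. [folklore] -/
theorem clean_step (c : (Fin 1 → ℕ) → κ) (i : Fin 1) (τ : Fin 1 → κ) :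
    clean p 1 κ (step p 1 κ i τ c) = step p 1 κ i τ c :=
  clean_clean _

/-- Under `MultP`, the cleaned order is `≥ p` (so the step divides by `u ^ p`). [folklore] -/
theorem le_ord_clean {c : (Fin 1 → ℕ) → κ} (hM : MultP p 1 κ c) : p ≤ ord 1 κ (clean p 1 κ c) := by
  have hM' : (∃ A, clean p 1 κ c A ≠ 0) ∧
      ∀ A, clean p 1 κ c A ≠ 0 → p ≤ Finset.sum Finset.univ (fun j => A j) := hM
  obtain ⟨⟨A₀, hA₀⟩, hmin⟩ := hM'
  show p ≤ sInf {m : ℕ | ∃ A, clean p 1 κ c A ≠ 0 ∧ m = Finset.sum Finset.univ (fun j => A j)}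
  exact le_csInf ⟨_, A₀, hA₀, rfl⟩ (by rintro _ ⟨A, hA, rfl⟩; exact hmin A hA)

/-- **The step in one variable, coefficientwise**: under `MultP c`, the successor's coefficient at
`u ^ b` is the cleaned coefficient of `c` at `u ^ (b + p)` ("divide the cleaned series by `u ^ p`";
the final cleaning never bites since `p ∣ b ↔ p ∣ b + p`). [folklore] -/
theorem step_apply {c : (Fin 1 → ℕ) → κ} (hM : MultP p 1 κ c) (i : Fin 1) (τ : Fin 1 → κ)
    (B : Fin 1 → ℕ) : step p 1 κ i τ c B = clean p 1 κ c (fun _ => B 0 + p) := by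
  obtain rfl : i = 0 := Subsingleton.elim _ _
  show clean p 1 κ (tr 1 κ 0 τ (@ite ℕ (p ≤ ord 1 κ (clean p 1 κ c)) (Classical.dec _) p 0)
    (dv 1 κ 0 (@ite ℕ (p ≤ ord 1 κ (clean p 1 κ c)) (Classical.dec _) p 0)
      (bl 1 κ 0 (clean p 1 κ c)))) B = _
  rw [if_pos (le_ord_clean hM), tr_zero, bl_zero]
  have hupd : Function.update B 0 (B 0 + p) = fun _ => B 0 + p := by
    funext j
    rw [Fin.fin_one_eq_zero j, Function.update_self]
  show @ite κ (∀ j, p ∣ B j) (Classical.dec _) 0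
    (clean p 1 κ c (Function.update B 0 (B 0 + p))) = _
  rw [hupd]
  by_cases hB : ∀ j, p ∣ B j
  · rw [if_pos hB]
    show (0 : κ) = @ite κ (∀ _j : Fin 1, p ∣ B 0 + p) (Classical.dec _) 0 (c fun _ => B 0 + p)
    rw [if_pos fun _ => dvd_add (hB 0) (dvd_refl p)]
  · rw [if_neg hB]

/-- In one variable the Jacobian ideal is principal, generated by `∂a/∂u`. [folklore] -/
theorem jac_one (c : (Fin 1 → ℕ) → κ) : jac p 1 κ c = Ideal.span {pd 1 κ 0 (ser p 1 κ c)} := by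
  show Ideal.span (Set.range fun i => pd 1 κ i (ser p 1 κ c)) = _
  rw [Set.range_unique]
  rfl

/-- A one-variable power series of exact `u`-order `m` generates the ideal `(u ^ m)`: it is
`u ^ m` times a unit. [folklore] -/
theorem span_eq_span_X_pow (f : MvPowerSeries (Fin 1) κ) (m : ℕ)
    (hlow : ∀ A : Fin 1 →₀ ℕ, A 0 < m → MvPowerSeries.coeff A f = 0)
    (hm : MvPowerSeries.coeff (Finsupp.single 0 m) f ≠ 0) :
    Ideal.span {f} = Ideal.span {(MvPowerSeries.X 0 : MvPowerSeries (Fin 1) κ) ^ m} := by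
  obtain ⟨g, hg⟩ := (MvPowerSeries.X_pow_dvd_iff (s := (0 : Fin 1)) (n := m) (φ := f)).mpr hlow
  have hg0 : MvPowerSeries.constantCoeff g ≠ 0 := by
    intro h0
    apply hm
    rw [hg, MvPowerSeries.X_pow_eq, MvPowerSeries.coeff_monomial_mul, if_pos le_rfl, tsub_self,
      one_mul, MvPowerSeries.coeff_zero_eq_constantCoeff_apply, h0]
  have hu : IsUnit g := MvPowerSeries.isUnit_iff_constantCoeff.mpr (Ne.isUnit hg0)
  rw [hg, Ideal.span_singleton_mul_right_unit hu]

/-- `dim_κ κ[[u]] ⧸ (u ^ m) = m`: the truncation below degree `m` is a `κ`-linear surjection onto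
`κ ^ m` with kernel `(u ^ m)`. [folklore] -/
theorem finrank_quot_span_X_pow (m : ℕ) :
    Module.finrank κ (MvPowerSeries (Fin 1) κ ⧸
      Ideal.span {(MvPowerSeries.X 0 : MvPowerSeries (Fin 1) κ) ^ m}) = m := by
  let φ : MvPowerSeries (Fin 1) κ →ₗ[κ] (Fin m → κ) :=
    LinearMap.pi fun k : Fin m => MvPowerSeries.coeff (Finsupp.single (0 : Fin 1) (k : ℕ))
  have hφ : ∀ (f : MvPowerSeries (Fin 1) κ) (k : Fin m),
      φ f k = MvPowerSeries.coeff (Finsupp.single (0 : Fin 1) (k : ℕ)) f := fun _ _ => rfl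
  have hker : LinearMap.ker φ =
      (Ideal.span {(MvPowerSeries.X 0 : MvPowerSeries (Fin 1) κ) ^ m}).restrictScalars κ := by
    ext f
    rw [LinearMap.mem_ker, Submodule.restrictScalars_mem, Ideal.mem_span_singleton,
      MvPowerSeries.X_pow_dvd_iff]
    constructor
    · intro h A hA
      have e : A = Finsupp.single 0 (A 0) := Finsupp.ext fun j => by
        rw [Fin.fin_one_eq_zero j, Finsupp.single_eq_same]
      have hk := congrFun h ⟨A 0, hA⟩
      rw [hφ] at hk
      rw [e]
      exact hk
    · intro h
      funext k
      rw [hφ]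
      exact h _ (by rw [Finsupp.single_eq_same]; exact k.2)
  have hsurj : Function.Surjective φ := by
    intro v
    refine ⟨(fun A : Fin 1 →₀ ℕ => if h : A 0 < m then v ⟨A 0, h⟩ else 0 : (Fin 1 →₀ ℕ) → κ), ?_⟩
    funext k
    rw [hφ]
    show (if h : (Finsupp.single (0 : Fin 1) (k : ℕ)) 0 < m
      then v ⟨(Finsupp.single (0 : Fin 1) (k : ℕ)) 0, h⟩ else 0) = v k
    rw [dif_pos (by rw [Finsupp.single_eq_same]; exact k.2)]
    exact congrArg v (Fin.ext Finsupp.single_eq_same)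
  calc Module.finrank κ (MvPowerSeries (Fin 1) κ ⧸
        Ideal.span {(MvPowerSeries.X 0 : MvPowerSeries (Fin 1) κ) ^ m})
      = Module.finrank κ (MvPowerSeries (Fin 1) κ ⧸
          (Ideal.span {(MvPowerSeries.X 0 : MvPowerSeries (Fin 1) κ) ^ m}).restrictScalars κ) :=
        (Submodule.Quotient.restrictScalarsEquiv κ _).finrank_eq.symm
    _ = Module.finrank κ (MvPowerSeries (Fin 1) κ ⧸ LinearMap.ker φ) := by rw [hker]
    _ = Module.finrank κ (Fin m → κ) := (φ.quotKerEquivOfSurjective hsurj).finrank_eq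
    _ = m := Module.finrank_fin_fun κ

/-- **Milnor number in one variable.** If `φ ∈ κ[[u]]` vanishes below degree `m ≥ 1` and
`m · φ_m ≠ 0` in `κ`, then `∂φ/∂u = u ^ (m - 1) · unit`, so `dim_κ κ[[u]] ⧸ (∂φ/∂u) = m - 1`.
[folklore] -/
theorem finrank_quot_span_pd (φ : MvPowerSeries (Fin 1) κ) (m : ℕ) (h1 : 1 ≤ m)
    (hlow : ∀ A : Fin 1 →₀ ℕ, A 0 < m → MvPowerSeries.coeff A φ = 0)
    (hm : (m : κ) * MvPowerSeries.coeff (Finsupp.single 0 m) φ ≠ 0) :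
    Module.finrank κ (MvPowerSeries (Fin 1) κ ⧸ Ideal.span {pd 1 κ 0 φ}) = m - 1 := by
  rw [span_eq_span_X_pow (pd 1 κ 0 φ) (m - 1), finrank_quot_span_X_pow]
  · intro A hA
    show ((A 0 + 1 : ℕ) : κ) * MvPowerSeries.coeff (A + Finsupp.single 0 1) φ = 0
    rw [hlow _ (by simp only [Finsupp.coe_add, Pi.add_apply, Finsupp.single_eq_same]; omega),
      mul_zero]
  · show ((Finsupp.single (0 : Fin 1) (m - 1) 0 + 1 : ℕ) : κ) *
      MvPowerSeries.coeff (Finsupp.single 0 (m - 1) + Finsupp.single 0 1) φ ≠ 0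
    rw [Finsupp.single_eq_same, ← Finsupp.single_add, Nat.sub_add_cancel h1]
    exact hm

/-- Under `MultP c` (one variable), the cleaned order `m` is attained at the exponent `(m)`, is
minimal among the exponents of non-zero cleaned coefficients, and satisfies `p ≤ m`, `p ∤ m`.
[folklore] -/
theorem ord_spec {c : (Fin 1 → ℕ) → κ} (hM : MultP p 1 κ c) :
    clean p 1 κ c (fun _ => ord 1 κ (clean p 1 κ c)) ≠ 0 ∧
      (∀ A, clean p 1 κ c A ≠ 0 → ord 1 κ (clean p 1 κ c) ≤ A 0) ∧
      p ≤ ord 1 κ (clean p 1 κ c) ∧ ¬ p ∣ ord 1 κ (clean p 1 κ c) := by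
  have hM' : (∃ A, clean p 1 κ c A ≠ 0) ∧
      ∀ A, clean p 1 κ c A ≠ 0 → p ≤ Finset.sum Finset.univ (fun j => A j) := hM
  obtain ⟨⟨A₀, hA₀⟩, hmin⟩ := hM'
  obtain ⟨A₁, hA₁, hmA₁⟩ := Nat.sInf_mem
    (s := {k : ℕ | ∃ A, clean p 1 κ c A ≠ 0 ∧ k = Finset.sum Finset.univ (fun j => A j)})
    ⟨_, A₀, hA₀, rfl⟩
  rw [Fin.sum_univ_one] at hmA₁
  have hm : ord 1 κ (clean p 1 κ c) = A₁ 0 := hmA₁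
  have hA₁eq : A₁ = fun _ => A₁ 0 := funext fun j => by rw [Fin.fin_one_eq_zero j]
  rw [hm]
  refine ⟨hA₁eq ▸ hA₁, fun A hA => ?_, ?_, fun hd => hA₁ ?_⟩
  · have h := Nat.sInf_le
      (s := {k : ℕ | ∃ A, clean p 1 κ c A ≠ 0 ∧ k = Finset.sum Finset.univ (fun j => A j)})
      ⟨A, hA, rfl⟩
    rw [Fin.sum_univ_one] at h
    exact hm ▸ h
  · have h := hmin A₁ hA₁
    rwa [Fin.sum_univ_one] at h
  · show @ite κ (∀ j, p ∣ A₁ j) (Classical.dec _) 0 (c A₁) = 0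
    rw [if_pos fun j => by rw [Fin.fin_one_eq_zero j]; exact hd]

end MuDropCurve

open MuDropCurve in
/-- **One-step Milnor drop for plane curves `z ^ p + a(u)` (`n = 1`).** In one variable the blow-up
chart and the translation are identities, so under `MultP c` a step divides the cleaned series
`f = Σ f_k u^k` (of order `m`, `p ≤ m`, `p ∤ m`, hence `m ≥ p + 1`) by `u ^ p`; since
`∂f/∂u = m f_m u^{m-1} + …` with `(m : κ) ≠ 0` (`CharP κ p`), `μ(c) = m - 1`, and likewise
`μ(step c) = m - p - 1 < m - 1`. [folklore] -/
theorem stub_muDropCurve : ∀ p : ℕ, p.Prime → ∀ (κ : Type) [Field κ] [CharP κ p] [PerfectField κ],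
    MuDrop p 1 κ := by
  intro p hp κ _ _ _ c i τ _ hM _ _
  obtain ⟨hA₁, hmin', hple, hpm⟩ := ord_spec hM
  generalize ord 1 κ (clean p 1 κ c) = m at hA₁ hmin' hple hpm
  have hlt : p < m := lt_of_le_of_ne hple (fun h => hpm (h ▸ dvd_refl p))
  have hmκ : (m : κ) ≠ 0 := fun h => hpm ((CharP.cast_eq_zero_iff κ p m).mp h)
  have hmpκ : ((m - p : ℕ) : κ) ≠ 0 := fun h => hpm (by
    have h' := dvd_add ((CharP.cast_eq_zero_iff κ p (m - p)).mp h) (dvd_refl p)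
    rwa [Nat.sub_add_cancel hple] at h')
  -- `μ(c) = m - 1`
  have hmu : mu p 1 κ c = m - 1 := by
    show Module.finrank κ (MvPowerSeries (Fin 1) κ ⧸ jac p 1 κ c) = m - 1
    rw [jac_one]
    refine finrank_quot_span_pd _ m (by omega) ?_ ?_
    · intro A hA
      show clean p 1 κ c ⇑A = 0
      by_contra hne
      exact absurd (hmin' _ hne) (not_le.mpr hA)
    · show (m : κ) * clean p 1 κ c ⇑(Finsupp.single (0 : Fin 1) m) ≠ 0
      have e : (⇑(Finsupp.single (0 : Fin 1) m) : Fin 1 → ℕ) = fun _ => m :=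
        funext fun j => by rw [Fin.fin_one_eq_zero j, Finsupp.single_eq_same]
      rw [e]
      exact mul_ne_zero hmκ hA₁
  -- `μ(step c) = m - p - 1`
  have hmu' : mu p 1 κ (step p 1 κ i τ c) = m - p - 1 := by
    show Module.finrank κ (MvPowerSeries (Fin 1) κ ⧸ jac p 1 κ (step p 1 κ i τ c)) = m - p - 1
    rw [jac_one]
    refine finrank_quot_span_pd _ (m - p) (by omega) ?_ ?_
    · intro A hA
      show clean p 1 κ (step p 1 κ i τ c) ⇑A = 0
      rw [clean_step, step_apply hM]
      by_contra hne
      have h := hmin' _ hne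
      omega
    · show ((m - p : ℕ) : κ) *
        clean p 1 κ (step p 1 κ i τ c) ⇑(Finsupp.single (0 : Fin 1) (m - p)) ≠ 0
      rw [clean_step, step_apply hM, Finsupp.single_eq_same, Nat.sub_add_cancel hple]
      exact mul_ne_zero hmpκ hA₁
  rw [hmu, hmu']
  have hp1 := hp.one_lt
  omega

end Summit.ResolutionOfSingularities.ResolutionOfSingularities.Theorems.WildCones

end
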